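import Literature.NumberTheory.EllipticCurves.ShaIsogenyProofs
import HarnessLib

/-!
# Isogenies on the rational points over an extension field; values of the base change

Topic `NumberTheory/EllipticCurves`; a proofs-only file (theorems only: no definitions, no named
facts).  For an isogeny `φ : E → E'` over `K` (the tree's `WeierstrassCurve.Isogeny`, recorded by
its action on `K̄`-points) and a field `M ⊇ K̄`, the tree has the base change
`φ_M : E(M) → E'(M)` (`Isogeny.baseChange`, file `IsogenyBaseChange`; for `M = L̄`, `L` a
`K`-field, this is `Isogeny.localPointsMap` of `ShaIsogenyProofs`).  This file descends `φ_{L̄}`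
to the `L`-RATIONAL points and makes the values of `φ_M` explicit:

* `WeierstrassCurve.Isogeny.baseChange_map_algEquiv`: `φ_{L̄}` commutes with `Aut(L̄/L)`
  (`Isogeny.map_baseChange` with the restriction `Aut(L̄/L) → Γ_K` of `Sha.lean`);
  `WeierstrassCurve.exists_baseChange_eq_of_forall_map_eq`: for `L` perfect, a point of `E(L̄)`
  fixed by `Aut(L̄/L)` comes from `E(L)` (Galois descent, Silverman *AEC* VIII.§1, as in the
  tree's `fixedPoints_eq_range_map_holds`);
* `WeierstrassCurve.Isogeny.exists_pointHom_baseChange_eq`: **the homomorphism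
  `φ_L : E(L) →+ E'(L)` on `L`-rational points** with `ι ∘ φ_L = φ_{L̄} ∘ ι`
  (`ι : E(L) → E(L̄)` the inclusion `Affine.Point.baseChange L L̄`) — for `L = K_v` this is
  Milne's `f(K_v) : A(K_v) → B(K_v)` (*ADT* I.7, proof of Thm. 7.3); `pointHom_eq_zero_iff`;
* `WeierstrassCurve.Isogeny.ker_baseChange_eq_map`, `finite_ker_baseChange`: the kernel of `φ_M`
  is the image of the (finite) kernel `E[φ] ⊆ E(K̄)` (generic points are never killed: `φ_M` of a
  generic point is an affine point); `Isogeny.finite_ker_pointHom`: hence `φ_L` has finite kernel;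
* `WeierstrassCurve.Isogeny.baseChange_some_eq_of_not_mem_image`: **the value of `φ_M` at every
  affine point off the image of the exceptional set of a rational representation
  `ρ = (P₁/Q₁, P₂/Q₂)` is `ρ(x, y)`**, with `Q₁(x, y), Q₂(x, y) ≠ 0` (at generic points this is
  the tree's `baseChangeFun_eq_evalPt`; at algebraic points it is the agreement of `φ` with `ρ`
  on `E(K̄)` transported along `K̄ → M`).

These are the inputs for computing `φ_{ℚ_p}` near `O` in the proof of the isogeny invariance of
the Birch–Swinnerton-Dyer quotient (Milne *ADT* Thm. I.7.3, step (V) at finite places; sibling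
files `PadicFiltrationLinearTermProofs`, `PadicFiltrationIndexProofs`).

## References

* J. H. Silverman, *The Arithmetic of Elliptic Curves*, 2nd ed., GTM 106 (2009), I.§3, III.§4
  (Cor. III.4.9), VIII.§1 (`E(K̄)^{G_K} = E(K)`). [SilvermanAEC2009]
* J. S. Milne, *Arithmetic Duality Theorems*, 2nd ed. (2006), Ch. I §7, proof of Thm. 7.3
  (the maps `f(K_v)`). [MilneADT2006]

## Design

Theorems only (D-0026).  The `K̄`-algebra structure on `L̄ = AlgebraicClosure L` is a typeclass
hypothesis `[Algebra K̄ L̄] [IsScalarTower K K̄ L̄]` (any `K`-embedding; the consumer uses the one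
of `Literature.NumberTheory.EllipticCurves.closureEmb L`, for which `φ.baseChange` is
`φ.localPointsMap L` by definition), so that all statements are about Mathlib's point types
`(W.baseChange _).toAffine.Point` and `Isogeny.baseChange`.  `φ_L` is produced existentially
(no definition), as `Isogeny.exists_pointHom` does for `L = K` (`IsogenyMordellWeilRankProofs`).
-/

noncomputable section

open scoped Classical

universe u v

namespace WeierstrassCurve

open Literature.NumberTheory.EllipticCurves
open Field (absoluteGaloisGroup)

variable {K : Type u} [Field K] {W W' : WeierstrassCurve K}

/-! ## `E(L)` inside `E(L̄)`: fixed points and descent -/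

section Descent

variable (W) (L : Type u) [Field L] [Algebra K L]

/-- `Point.map` of an `L`-automorphism of `L̄` viewed over `K` or over `L` is the same map (it acts
on coordinates). [folklore] -/
theorem map_restrictScalars_eq (τ : AlgebraicClosure L ≃ₐ[L] AlgebraicClosure L)
    (P : (W.baseChange (AlgebraicClosure L)).toAffine.Point) :
    Affine.Point.map ((AlgEquiv.restrictScalars K τ : AlgebraicClosure L ≃ₐ[K] AlgebraicClosure L) :
        AlgebraicClosure L →ₐ[K] AlgebraicClosure L) P =
      Affine.Point.map (τ : AlgebraicClosure L →ₐ[L] AlgebraicClosure L) P := by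
  rcases P with _ | ⟨x, y, h⟩ <;> rfl

/-- Points of `E(L)` are fixed by `Aut(L̄/L)` in `E(L̄)` (Mathlib's `Affine.Point.map_baseChange`).
Silverman, *AEC*, VIII.§1. [folklore] -/
theorem map_baseChange_algebraicClosure (τ : AlgebraicClosure L ≃ₐ[L] AlgebraicClosure L)
    (Q : (W.baseChange L).toAffine.Point) :
    Affine.Point.map (τ : AlgebraicClosure L →ₐ[L] AlgebraicClosure L)
        (Affine.Point.baseChange (W' := W) L (AlgebraicClosure L) Q) =
      Affine.Point.baseChange (W' := W) L (AlgebraicClosure L) Q :=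
  Affine.Point.map_baseChange _ Q

/-- **Galois descent in `E(L̄)`** (`L` perfect): a point of `E(L̄)` fixed by `Aut(L̄/L)` comes from
`E(L)` (`L̄/L` is Galois, so fixed coordinates lie in `L`, Mathlib's
`InfiniteGalois.mem_range_algebraMap_iff_fixed`). Silverman, *AEC*, I.§1, VIII.§1.
[cite: SilvermanAEC2009, I.§1 and VIII.§1 (proof of Prop. 1.2)] -/
theorem exists_baseChange_eq_of_forall_map_eq [PerfectField L]
    {R : (W.baseChange (AlgebraicClosure L)).toAffine.Point}
    (hR : ∀ τ : AlgebraicClosure L ≃ₐ[L] AlgebraicClosure L,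
      Affine.Point.map (τ : AlgebraicClosure L →ₐ[L] AlgebraicClosure L) R = R) :
    ∃ Q : (W.baseChange L).toAffine.Point,
      Affine.Point.baseChange (W' := W) L (AlgebraicClosure L) Q = R := by
  haveI : IsGalois L (AlgebraicClosure L) := {}
  rcases R with _ | ⟨x, y, h⟩
  · exact ⟨0, rfl⟩
  · have hxy : ∀ τ : AlgebraicClosure L ≃ₐ[L] AlgebraicClosure L, τ x = x ∧ τ y = y := by
      intro τ
      have := hR τ
      rw [Affine.Point.map_some] at this
      simpa only [Affine.Point.some.injEq, AlgEquiv.coe_toAlgHom] using this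
    obtain ⟨x₀, rfl⟩ :=
      (InfiniteGalois.mem_range_algebraMap_iff_fixed x).mpr fun τ => (hxy τ).1
    obtain ⟨y₀, rfl⟩ :=
      (InfiniteGalois.mem_range_algebraMap_iff_fixed y).mpr fun τ => (hxy τ).2
    have h₀ : (W.baseChange L).toAffine.Nonsingular x₀ y₀ :=
      (Affine.baseChange_nonsingular W (Algebra.ofId L (AlgebraicClosure L)).injective x₀ y₀).mp h
    exact ⟨Affine.Point.some x₀ y₀ h₀, rfl⟩

/-- `ι : E(L) → E(L̄)` is injective. [folklore] -/
theorem baseChange_algebraicClosure_injective :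
    Function.Injective (Affine.Point.baseChange (W' := W) L (AlgebraicClosure L)) :=
  Affine.Point.map_injective _

end Descent

/-! ## The kernel and the values of `φ_M` -/

namespace Isogeny

section BaseChange

variable {M : Type v} [Field M] [Algebra K M] [Algebra (AlgebraicClosure K) M]
  [IsScalarTower K (AlgebraicClosure K) M] (φ : Isogeny W W')

/-- **The kernel of `φ_M` is the image of `E[φ] ⊆ E(K̄)`**: a generic point of `E(M)` is mapped to
an affine point (`baseChangeFun_some_of_generic`), and on `ι_* E(K̄)` the map is
`ι_* ∘ φ ∘ ι_*⁻¹`. Silverman, *AEC*, III.4.9 (the kernel of an isogeny is a finite set of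
algebraic points). [folklore] -/
theorem ker_baseChange_eq_map :
    (φ.baseChange (M := M)).ker =
      φ.toAddMonoidHom.ker.map
        (Affine.Point.map (W' := W) (IsScalarTower.toAlgHom K (AlgebraicClosure K) M)) := by
  ext R
  rw [AddMonoidHom.mem_ker, AddSubgroup.mem_map]
  constructor
  · intro hR
    by_cases hmem : R ∈ Set.range
        (Affine.Point.map (W' := W) (IsScalarTower.toAlgHom K (AlgebraicClosure K) M))
    · obtain ⟨P₀, rfl⟩ := hmem
      refine ⟨P₀, ?_, rfl⟩
      rw [φ.baseChange_map] at hR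
      change φ P₀ = 0
      exact Affine.Point.map_injective _ (hR.trans rfl)
    · exfalso
      rcases R with _ | ⟨x, y, hxy⟩
      · exact hmem ⟨0, by rw [← Affine.Point.zero_def, map_zero]⟩
      · rw [φ.baseChange_apply, φ.baseChangeFun_some_of_generic hxy hmem] at hR
        exact Affine.Point.some_ne_zero _ hR
  · rintro ⟨P₀, hP₀, rfl⟩
    replace hP₀ : φ P₀ = 0 := hP₀
    rw [φ.baseChange_map, hP₀]
    rfl

/-- The kernel of `φ_M` is finite. Silverman, *AEC*, III.4.9. [cite: SilvermanAEC2009, III.4, Cor. 4.9] -/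
theorem finite_ker_baseChange :
    ((φ.baseChange (M := M)).ker : Set (W.baseChange M).toAffine.Point).Finite := by
  rw [φ.ker_baseChange_eq_map, AddSubgroup.coe_map]
  exact φ.finite_ker.image _

omit [Algebra K M] [IsScalarTower K (AlgebraicClosure K) M] in
/-- Polynomial values along `K̄ → M`: `P(ι x, ι y) = ι (P(x, y))`. [folklore] -/
theorem aeval_vec₂_algebraMap (P : MvPolynomial (Fin 2) (AlgebraicClosure K))
    (x y : AlgebraicClosure K) :
    MvPolynomial.aeval ![algebraMap (AlgebraicClosure K) M x, algebraMap (AlgebraicClosure K) M y] P =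
      algebraMap (AlgebraicClosure K) M (MvPolynomial.eval ![x, y] P) := by
  rw [MvPolynomial.aeval_def]
  have h := MvPolynomial.eval₂_comp_left (algebraMap (AlgebraicClosure K) M) (RingHom.id _) ![x, y] P
  rw [RingHom.comp_id] at h
  have hv : (algebraMap (AlgebraicClosure K) M) ∘ ![x, y] =
      ![algebraMap (AlgebraicClosure K) M x, algebraMap (AlgebraicClosure K) M y] := by
    funext i; fin_cases i <;> rfl
  rw [hv] at h
  exact h.symm

/-- **The value of `φ_M` off the exceptional set of a rational representation.** For any rational
representation `ρ = (P₁/Q₁, P₂/Q₂)` of `φ` and any affine point `(x, y) ∈ E(M)` which is not the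
image of an exceptional point of `ρ` (a finite subset of `E(K̄)`): `Q₁(x, y) ≠ 0`, `Q₂(x, y) ≠ 0`
and `φ_M (x, y) = (P₁/Q₁, P₂/Q₂)(x, y)`.  At generic points this is the tree's
`baseChangeFun_eq_evalPt`; at a point `ι_* P₀`, `P₀ ∉ exc ρ`, it is the agreement of `φ` with `ρ`
at `P₀` transported along `ι`. Silverman, *AEC*, I.§3, III.§4. [folklore] -/
theorem baseChange_some_eq_of_not_mem_image (ρ : RatRep W W' φ) {x y : M}
    (hxy : (W.baseChange M).toAffine.Nonsingular x y)
    (hR : (Affine.Point.some x y hxy : (W.baseChange M).toAffine.Point) ∉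
      Affine.Point.map (W' := W) (IsScalarTower.toAlgHom K (AlgebraicClosure K) M) ''
        (ρ.exc : Set W.geomPoints)) :
    MvPolynomial.aeval ![x, y] ρ.Q₁ ≠ 0 ∧ MvPolynomial.aeval ![x, y] ρ.Q₂ ≠ 0 ∧
      ∃ h', φ.baseChange (M := M) (.some x y hxy) =
        .some (MvPolynomial.aeval ![x, y] ρ.P₁ / MvPolynomial.aeval ![x, y] ρ.Q₁)
          (MvPolynomial.aeval ![x, y] ρ.P₂ / MvPolynomial.aeval ![x, y] ρ.Q₂) h' := by
  by_cases hmem : (Affine.Point.some x y hxy : (W.baseChange M).toAffine.Point) ∈ Set.range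
      (Affine.Point.map (W' := W) (IsScalarTower.toAlgHom K (AlgebraicClosure K) M))
  · -- algebraic point `ι_* P₀` with `P₀ ∉ exc ρ`
    obtain ⟨P₀, hP₀⟩ := hmem
    have hP₀exc : P₀ ∉ ρ.exc := fun h => hR ⟨P₀, h, hP₀⟩
    rcases P₀ with _ | ⟨x₀, y₀, h₀⟩
    · exact absurd hP₀.symm
        (by rw [← Affine.Point.zero_def, map_zero]; exact Affine.Point.some_ne_zero _)
    · obtain ⟨hQ₁, hQ₂, h', hφ⟩ := ρ.apply_eq_of_not_mem_exc h₀ hP₀exc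
      rw [Affine.Point.map_some] at hP₀
      obtain ⟨hx, hy⟩ := (Affine.Point.some.injEq _ _ _ _ _ _).mp hP₀
      have hιx : algebraMap (AlgebraicClosure K) M x₀ = x := hx
      have hιy : algebraMap (AlgebraicClosure K) M y₀ = y := hy
      subst hιx hιy
      rw [aeval_vec₂_algebraMap, aeval_vec₂_algebraMap, aeval_vec₂_algebraMap,
        aeval_vec₂_algebraMap]
      refine ⟨by rwa [map_ne_zero], by rwa [map_ne_zero], ?_⟩
      have hval : φ.baseChange (M := M) (.some _ _ hxy) =
          Affine.Point.map (IsScalarTower.toAlgHom K (AlgebraicClosure K) M)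
            (φ (.some x₀ y₀ h₀)) := by
        rw [← φ.baseChange_map]
        rfl
      rw [hφ, Affine.Point.map_some] at hval
      obtain ⟨h'', e⟩ := Affine.Point.exists_eq_some_of_eq hval
        (map_div₀ (algebraMap (AlgebraicClosure K) M) (MvPolynomial.eval ![x₀, y₀] ρ.P₁)
          (MvPolynomial.eval ![x₀, y₀] ρ.Q₁))
        (map_div₀ (algebraMap (AlgebraicClosure K) M) (MvPolynomial.eval ![x₀, y₀] ρ.P₂)
          (MvPolynomial.eval ![x₀, y₀] ρ.Q₂))
      exact ⟨h'', e⟩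
  · -- generic point
    have hx := (not_mem_range_of_not_mem_range_map hxy hmem).1
    obtain ⟨hQ₁, hQ₂⟩ := ρ.aeval_ne_zero_of_generic hxy hx
    refine ⟨hQ₁, hQ₂, ρ.nonsingular_aeval_of_generic hxy hx, ?_⟩
    rw [φ.baseChange_apply, φ.baseChangeFun_eq_evalPt ρ hxy hmem,
      ρ.evalPt_eq_some_of_generic hxy hx]

end BaseChange

/-! ## The homomorphism on `L`-rational points -/

section Rational

variable (L : Type u) [Field L] [Algebra K L]
  [Algebra (AlgebraicClosure K) (AlgebraicClosure L)]
  [IsScalarTower K (AlgebraicClosure K) (AlgebraicClosure L)] (φ : Isogeny W W')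

/-- **`φ_{L̄}` commutes with `Aut(L̄/L)`**: `φ_{L̄} (τ • P) = τ • φ_{L̄} P` — the semilinear
functoriality `Isogeny.map_baseChange` for `f = τ` and `σ = τ|_{K̄} ∈ Γ_K`
(`Literature.NumberTheory.EllipticCurves.resGalAuxOfEmb`, `apply_resGalAuxOfEmb_apply`).
Silverman, *AEC*, I.§3 (`φ(P)^σ = φ^σ(P^σ) = φ(P^σ)` for `φ` defined over `K`). [folklore] -/
theorem baseChange_map_algEquiv (τ : AlgebraicClosure L ≃ₐ[L] AlgebraicClosure L)
    (P : (W.baseChange (AlgebraicClosure L)).toAffine.Point) :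
    φ.baseChange (M := AlgebraicClosure L)
        (Affine.Point.map (τ : AlgebraicClosure L →ₐ[L] AlgebraicClosure L) P) =
      Affine.Point.map (τ : AlgebraicClosure L →ₐ[L] AlgebraicClosure L)
        (φ.baseChange (M := AlgebraicClosure L) P) := by
  rw [← map_restrictScalars_eq W L τ P, ← map_restrictScalars_eq W' L τ]
  symm
  exact φ.map_baseChange
    (AlgEquiv.restrictScalars K τ : AlgebraicClosure L →ₐ[K] AlgebraicClosure L)
    (resGalAuxOfEmb (IsScalarTower.toAlgHom K (AlgebraicClosure K) (AlgebraicClosure L)) τ)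
    (fun c ↦ (apply_resGalAuxOfEmb_apply
      (IsScalarTower.toAlgHom K (AlgebraicClosure K) (AlgebraicClosure L)) τ c).symm) P

/-- **An isogeny over `K` acts on the `L`-rational points**, for every perfect `K`-field `L`:
there is a homomorphism `φ_L : E(L) →+ E'(L)` with `ι (φ_L Q) = φ_{L̄} (ι Q)` in `E'(L̄)`
(`ι = Affine.Point.baseChange L L̄`, `φ_{L̄} = φ.baseChange`).  Galois descent: `φ_{L̄}` commutes
with `Aut(L̄/L)` (`baseChange_map_algEquiv`), so it maps `E(L) = E(L̄)^{Aut(L̄/L)}` into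
`E'(L̄)^{Aut(L̄/L)} = E'(L)`; additivity from the injectivity of `ι`.  For `L = K_v` this is
Milne's `f(K_v)` (*ADT* I.7, proof of Thm. 7.3). [cite: SilvermanAEC2009, III.§4 with VIII.§1] -/
theorem exists_pointHom_baseChange_eq [PerfectField L] :
    ∃ f : (W.baseChange L).toAffine.Point →+ (W'.baseChange L).toAffine.Point,
      ∀ Q : (W.baseChange L).toAffine.Point,
        Affine.Point.baseChange (W' := W') L (AlgebraicClosure L) (f Q) =
          φ.baseChange (M := AlgebraicClosure L)
            (Affine.Point.baseChange (W' := W) L (AlgebraicClosure L) Q) := by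
  have hex : ∀ Q : (W.baseChange L).toAffine.Point, ∃ R : (W'.baseChange L).toAffine.Point,
      Affine.Point.baseChange (W' := W') L (AlgebraicClosure L) R =
        φ.baseChange (M := AlgebraicClosure L)
          (Affine.Point.baseChange (W' := W) L (AlgebraicClosure L) Q) :=
    fun Q => exists_baseChange_eq_of_forall_map_eq W' L fun τ => by
      rw [← φ.baseChange_map_algEquiv L τ, map_baseChange_algebraicClosure W L τ Q]
  choose f hf using hex
  refine ⟨AddMonoidHom.mk' f fun P Q => baseChange_algebraicClosure_injective W' L ?_, hf⟩
  rw [map_add, hf, hf, hf, map_add, map_add]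

variable {L}

/-- The kernel of `φ_L`: `φ_L Q = O ↔ ι Q ∈ ker φ_{L̄}`. [folklore] -/
theorem pointHom_eq_zero_iff {f : (W.baseChange L).toAffine.Point →+ (W'.baseChange L).toAffine.Point}
    (hf : ∀ Q : (W.baseChange L).toAffine.Point,
      Affine.Point.baseChange (W' := W') L (AlgebraicClosure L) (f Q) =
        φ.baseChange (M := AlgebraicClosure L)
          (Affine.Point.baseChange (W' := W) L (AlgebraicClosure L) Q))
    (Q : (W.baseChange L).toAffine.Point) :
    f Q = 0 ↔ φ.baseChange (M := AlgebraicClosure L)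
      (Affine.Point.baseChange (W' := W) L (AlgebraicClosure L) Q) = 0 := by
  rw [← hf Q]
  constructor
  · intro h; rw [h, map_zero]
  · intro h
    exact baseChange_algebraicClosure_injective W' L (h.trans (map_zero _).symm)

/-- **`φ_L` has finite kernel** (it embeds into `ker φ_{L̄} = ι_*(E[φ])`). Silverman, *AEC*,
III.4.9. [cite: SilvermanAEC2009, III.4, Cor. 4.9] -/
theorem finite_ker_pointHom {f : (W.baseChange L).toAffine.Point →+ (W'.baseChange L).toAffine.Point}
    (hf : ∀ Q : (W.baseChange L).toAffine.Point,
      Affine.Point.baseChange (W' := W') L (AlgebraicClosure L) (f Q) =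
        φ.baseChange (M := AlgebraicClosure L)
          (Affine.Point.baseChange (W' := W) L (AlgebraicClosure L) Q)) :
    (f.ker : Set (W.baseChange L).toAffine.Point).Finite := by
  have hfin := φ.finite_ker_baseChange (M := AlgebraicClosure L)
  refine (hfin.preimage (baseChange_algebraicClosure_injective W L).injOn).subset fun Q hQ => ?_
  rw [Set.mem_preimage, SetLike.mem_coe, AddMonoidHom.mem_ker, ← φ.pointHom_eq_zero_iff hf]
  exact hQ

/-- The value of `φ_L` at an `L`-point, read in `E'(L̄)`: if `φ_{L̄} (ι Q) = (x', y')` with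
`x' = ι a`, `y' = ι b`, then `φ_L Q = (a, b)`. [folklore] -/
theorem pointHom_eq_some_of_baseChange_eq
    {f : (W.baseChange L).toAffine.Point →+ (W'.baseChange L).toAffine.Point}
    (hf : ∀ Q : (W.baseChange L).toAffine.Point,
      Affine.Point.baseChange (W' := W') L (AlgebraicClosure L) (f Q) =
        φ.baseChange (M := AlgebraicClosure L)
          (Affine.Point.baseChange (W' := W) L (AlgebraicClosure L) Q))
    {Q : (W.baseChange L).toAffine.Point} {a b : L}
    {h' : (W'.baseChange (AlgebraicClosure L)).toAffine.Nonsingular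
      (algebraMap L (AlgebraicClosure L) a) (algebraMap L (AlgebraicClosure L) b)}
    (hval : φ.baseChange (M := AlgebraicClosure L)
      (Affine.Point.baseChange (W' := W) L (AlgebraicClosure L) Q) = .some _ _ h') :
    ∃ h, f Q = .some a b h := by
  have hab : (W'.baseChange L).toAffine.Nonsingular a b :=
    (Affine.baseChange_nonsingular W' (Algebra.ofId L (AlgebraicClosure L)).injective a b).mp h'
  refine ⟨hab, baseChange_algebraicClosure_injective W' L ?_⟩
  rw [hf Q, hval]
  rfl

end Rational

end Isogeny

end WeierstrassCurve
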